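import Summits.ResolutionOfSingularities.ResolutionOfSingularities.Theorems.MarkedTransferCampaignW46TameSurfaceOrderReductionBoundary
import Summits.ResolutionOfSingularities.ResolutionOfSingularities.Theorems.MarkedTransferCampaignW46LiteralCentreProcrastination
import Literature.AlgebraicGeometry.Resolution.KollarSurfaceMarkedOrderReductionTameIntegral
import HarnessLib

/-!
# [OURS · L1 W4.6, rung (iv) «large characteristic» ∩ rung (i) «surfaces»] In the regime `charGT n (fun _ b ↦ b)` on a surface
# ambient, Kollár's characteristic-zero algorithm resolves the typed ideal with EVERY marking `m` (for `p > m(m-1)`) and PRINCIPALIZES it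
# (cell res-hironaka, LADDER-RESOLUTION rung L, D-0089; slot W4.6, seat res-L1-s46-pv-7; host route MarkedTransfer,
# `--supports stmt-ResolutionOfSingularities-16155 --as helper`)

HONEST FRAMING. Nothing here is a statement of H. Hironaka's manuscript (2017-03-23, [Hironaka2017]) and nothing here
asserts that any statement of it holds. OURS corollary, over the shared typed-procedure module (res-L1-type-o1:
`CampaignW46.Regime.charGT`; the manuscript enters only through the typed CANDIDATE carriers `AmbientDatum`,
`IdealExponent`, `IdealExponent.IsStandard`, used as definitions), of this seat's Literature files
`KollarSurfaceMarkedOrderReductionTame.lean` / `…TameIntegral.lean` (Kollár's Thm. 3.69 for marked ideals on surface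
triples in the tame regime, ANY marking, via 3.111 Steps 1–3 over the boundary theorem; principalization = Thm. 3.21
shape). No premise of the manuscript, no FACT-LIST premise. AI review is weaker than expert review. No `sorry`, no new
definition; axioms standard.

## What this file pins — the honest `C` for marked ideals on surfaces: `p > max(max-ord, m(m-1))`

* **`exists_isResolutionOf_marked_of_charGT_surface`** — for a state `(A, E)`, `E = (J, b)` standard, over a PERFECT field
  `K` of characteristic `p`, `A.Z` of dimension `2`, in `Regime.charGT n (fun _ b ↦ b)` («`p > b`»), with `max-ord J ≤ b`, any
  simple normal crossing boundary `B` (no repeated non-empty member) and ANY marking `1 ≤ m` with `m(m-1) < p`: there is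
  `s : CentreSeq Z` RESOLVING `(Z, J, B, m)`;
* **`exists_principalization_of_charGT_surface`** — `m = 1`, `B = ∅`: a smooth blow-up sequence PRINCIPALIZING `J`
  (final controlled transform the unit ideal), for every state of a surface ambient in the regime `p > b ≥ max-ord J`.

## References (context; nothing is cited as a premise)

* J. Kollár, *Lectures on Resolution of Singularities* (2007), Thm. 3.69, Thm. 3.21, 3.111 — through this seat's Literature
  files. [cite: Kollar2007, Thm. 3.69]
* E. Bierstone, D. Grigoriev, P. Milman, J. Włodarczyk (2011), Def. 3.1.3, Thm. 8.0.4. [cite: BierstoneGrigorievMilmanWlodarczyk2011, Thm. 8.0.4]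
-/

noncomputable section

set_option linter.dupNamespace false -- mandated namespace of this single-conjunct summit

open CategoryTheory AlgebraicGeometry TopologicalSpace IsLocalRing

namespace Summit.ResolutionOfSingularities.ResolutionOfSingularities.Theorems
namespace CampaignW46
namespace TameSurfaceOrderReduction

open Literature.AlgebraicGeometry.Resolution
open Literature.AlgebraicGeometry.Hironaka2017.S02Preliminaries

universe u

variable {n : ℕ} {p : ℕ} [Fact p.Prime] {K : Type u} [Field K] [CharP K p]

/-- [OURS · L1 W4.6 (iv) ∩ (i); NOT a statement of the manuscript] **In the regime `charGT n (fun _ b ↦ b)` on a surface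
ambient, Kollár's algorithm resolves the typed ideal with every marking `m`, `m(m-1) < p`, and every simple normal
crossing boundary.** For a state `(A, E)` over a perfect field `K` of characteristic `p` with `dim Z = 2`, `E = (J, b)`
standard (`J ≠ 0`), `p > b ≥ max-ord J`, `B` an snc boundary without repeated non-empty members, and `1 ≤ m` with
`m(m-1) < p`: a blow-up sequence on `Z` resolves `(Z, J, B, m)` (`Z` is integral, smooth and quasi-compact over `K`;
`Kollar2007.exists_isResolutionOf_marked_of_isIntegral_surface`). [cite: Kollar2007, Thm. 3.69, 3.111]
[cite: BierstoneGrigorievMilmanWlodarczyk2011, Def. 3.1.3, Thm. 8.0.4] -/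
theorem exists_isResolutionOf_marked_of_charGT_surface [PerfectField K] (A : AmbientDatum p K)
    (E : IdealExponent A.Z) (hE : Regime.charGT (p := p) (K := K) n (fun _ b => b) A E) (hstd : E.IsStandard)
    (hdim : topologicalKrullDim A.Z = 2) (hmax : ∀ ξ : A.Z, idealOrder E.J ξ ≤ E.b)
    {B : List A.Z.IdealSheafData} (hB : HasSNC B) (hBpw : B.Pairwise fun D D' => D = D' → D = ⊤)
    {m : ℕ} (hm : 1 ≤ m) (hmp : m * (m - 1) < p) :
    ∃ s : CentreSeq A.Z, s.IsResolutionOf ⟨E.J, B, m⟩ := by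
  letI : A.Z.Over (Spec (.of K)) := ⟨A.hom⟩
  haveI : Smooth (A.Z ↘ Spec (.of K)) := A.smooth
  haveI : QuasiCompact (A.Z ↘ Spec (.of K)) := A.quasiCompact
  haveI : IsIntegral A.Z := ambient_isIntegral A
  have hbp : E.b < p := hE
  exact Kollar2007.exists_isResolutionOf_marked_of_isIntegral_surface K A.Z p hdim E.J hstd.1 hB hBpw hm hmax
    (Or.inr ⟨hbp, hmp⟩)

/-- [OURS · L1 W4.6 (iv) ∩ (i)] **PRINCIPALIZATION of the typed ideal on a surface ambient in the regime
`charGT n (fun _ b ↦ b)`** (Kollár Thm. 3.21 shape): for a state `(A, E)` over a perfect field `K` of characteristic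
`p` with `dim Z = 2`, `E = (J, b)` standard and `p > b ≥ max-ord J`, there is a smooth blow-up sequence on `Z` — regular
centres in the successive zero loci, simple normal crossings with the exceptional divisors — whose final controlled
transform of `J` (multiplicity one) is the unit ideal. [cite: Kollar2007, Thm. 3.21, Thm. 3.69]
[cite: BierstoneGrigorievMilmanWlodarczyk2011, §3.3, Thm. 8.0.4] -/
theorem exists_principalization_of_charGT_surface [PerfectField K] (A : AmbientDatum p K)
    (E : IdealExponent A.Z) (hE : Regime.charGT (p := p) (K := K) n (fun _ b => b) A E) (hstd : E.IsStandard)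
    (hdim : topologicalKrullDim A.Z = 2) (hmax : ∀ ξ : A.Z, idealOrder E.J ξ ≤ E.b) :
    ∃ s : CentreSeq A.Z, s.IsAdmissibleFor ⟨E.J, [], 1⟩ ∧ (s.transformMarked ⟨E.J, [], 1⟩).ideal = ⊤ := by
  letI : A.Z.Over (Spec (.of K)) := ⟨A.hom⟩
  haveI : Smooth (A.Z ↘ Spec (.of K)) := A.smooth
  haveI : QuasiCompact (A.Z ↘ Spec (.of K)) := A.quasiCompact
  haveI : IsIntegral A.Z := ambient_isIntegral A
  have hbp : E.b < p := hE
  exact Kollar2007.exists_principalization_of_isIntegral_surface K A.Z p hdim E.J hstd.1 hmax (Or.inr hbp)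

end TameSurfaceOrderReduction
end CampaignW46
end Summit.ResolutionOfSingularities.ResolutionOfSingularities.Theorems

end
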